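import Literature.NumberTheory.EllipticCurves.SkinnerUrban2014.PAdicUnitPeriodRatioProofs
import Literature.NumberTheory.EllipticCurves.RealLatticeRealLocusProofs
import HarnessLib

/-!
# Greenberg–Vatsal 2000, Remark 3.4 at EVERY prime (including `p = 2`): with `E[p]` irreducible the
# Néron period is a `p`-adic unit multiple of the period of the newform — PROVED from the Manin
# constant of the optimal curve, with no factor-`2` slack (theorems only)

A *proofs* file (theorems only: no definition, no named fact; D-0014/D-0026), sibling of
`SkinnerUrban2014/PAdicUnitPeriodRatioProofs.lean`. That file proves, for an ODD prime `p` with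
`E[p]` irreducible and `p ∤ c₀` (the Manin constant of the lattice-optimal datum),
`Ω(W) = u · Ω⁺_f`, `u ∈ ℚ`, `‖u‖_p = 1` (`exists_unit_mul_plusPeriod_of_irreducible`), with
`u = n a |c₀| / (q m n₀)` where `n, n₀, m ∣ 2` are real-component / lattice-shape factors — the only
reason for its binder `hp2 : p ≠ 2`. Here the three factors of `2` are REMOVED by working with the
"half Néron period" `Ω(W)/2 = gen(re Λ_W)` instead of the least real period `Ω₀`:

* §1 `exists_mem_lattice_re_eq_realPeriodRat_div_two`: **`re Λ_E = ℤ · Ω(W)/2` exactly** — the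
  tree had `⊆` (`exists_re_eq_int_mul_realPeriodRat_div_two`); the generator is attained: `Ω₀ ∈ Λ`
  with `Ω = 2Ω₀` if `Δ > 0` (rectangular), and `iΩ₀'/2 + Ω₀/2 ∈ Λ` with `Ω = Ω₀` if `Δ < 0`
  (rhombic; `IsReal.discr_pos_of_halfPeriodI_add_notMem`, Lawden §6.16) (Cremona 1997 §2.8:
  "in each case `Ω(f)` is twice the least real part of a period").
* §2 `exists_int_mul_realPeriodRat_eq_of_isogeny`: for a `ℚ`-isogeny `ψ : W → W'` of degree `d`
  between GLOBALLY MINIMAL models, integers `q ∣ d`, `ab = d` with `q · Ω(W) = a · Ω(W')` (the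
  multiplier `q ∈ ℤ` and `d/q ∈ ℤ` by Néron integrality, `integral_neronScaling_of_isGloballyMinimal_holds`;
  `re(qΛ) ⊆ re Λ'` and `re((d/q)Λ') ⊆ re Λ` on the generators of §1).
* §3 `realPeriodRat_eq_abs_mul_plusPeriod_of_latticeEq`: for a lattice-optimal datum
  (`Λ_{W₀} = c₀Λ_f`), **`Ω(W₀) = |c₀| · Ω⁺_f` EXACTLY** (`m = 1` in the tree's
  `exists_dvd_two_mul_realPeriodRat_eq_of_latticeEq`): `re Λ_{W₀} = c₀ · re Λ_f`, and both sides are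
  cyclic with positive generators `Ω(W₀)/2`, `|c₀|Ω⁺_f/2`.
* §4 **`exists_unit_mul_plusPeriod_of_irreducible_anyPrime`**: `W` globally minimal, `p` ANY prime,
  `E[p]` irreducible, `f` the newform, `p ∤ c₀` ⇒ `Ω(W) = u · Ω⁺_f`, `u = a|c₀|/q`, `‖u‖_p = 1`
  (`p ∤ a, q` because the isogeny `W → W₀` has degree prime to `p`,
  `exists_isogeny_not_dvd_degree_of_irreducible`).
* §5 the `p = 2` named consequences from the tree's Manin-constant facts (statements of
  `ManinConstantSemistablePrimewise.lean`, NOT discharged here):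
  `realPeriodRat_eq_unit_mul_plusPeriod_two_of_abbesUllmo` (good reduction at `2`, i.e. `2 ∤ N`:
  Abbes–Ullmo 1996 Thm. A, `abbesUllmo_not_dvd_maninConstant_of_not_dvd_level`),
  `realPeriodRat_eq_unit_mul_plusPeriod_two_of_cesnavicius` (multiplicative at `2`, i.e. `2 ∥ N`:
  Česnavičius 2018 Thm. 1.2, `cesnavicius_not_two_dvd_maninConstant_of_two_dvd_level`), the
  semistable-at-`2` union `exists_unit_mul_plusPeriod_two_of_not_additive`, and the inline binder form
  `padicValRat_two_periodRatio_eq_zero` (`ϖ · Ω(W) = Ω⁺_f ⇒ ord₂ ϖ = 0`) consumed by the residual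
  cell `b2b-bsdres` (class O1 = X5 at `p = 2`: o1 lead PLAN v2.2 C24 "A-PER2", the period slack
  `m = 0` of the END-STATE `X5/TwoAdicTargetsEndState.lean`); and, BY NAME, the named fact
  `realPeriodRat_eq_unit_mul_plusPeriod_two` of `ModularCurvePeriodRatio.lean` from the Abbes–Ullmo fact
  alone (`realPeriodRat_eq_unit_mul_plusPeriod_two_fact_of_abbesUllmo`), with the conjunction
  `periodUnit_good_facts_of_abbesUllmo` (the `p ≥ 5` / `3` / `2` good-reduction period facts are one
  print input).

Greenberg–Vatsal's Remark 3.4 ("If `E` does not admit any `p`-isogenies, so that `E[p]` is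
irreducible, then it is clear that the Néron periods of any isogenous curve differ from those of `E`
by a `p`-adic unit") has no parity restriction; the `p = 2` Manin input is Česnavičius 2018 Thm. 1.2
("existing techniques suffice if `p` is odd, so the key new case is `p = 2`") / Abbes–Ullmo Thm. A.

## References

* R. Greenberg, V. Vatsal, *On the Iwasawa invariants of elliptic curves*, Invent. Math. 142
  (2000), §3, Remark 3.4. [GreenbergVatsal2000]
* K. Česnavičius, *The Manin constant in the semistable case*, Compositio Math. 154 (2018)
  1889–1920 = arXiv:1703.02951, Thm. 1.2. [Cesnavicius2018]
* A. Abbes, E. Ullmo, Compositio Math. 103 (1996), Thm. A. [AbbesUllmo1996]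
* B. Edixhoven, *On the Manin constants of modular elliptic curves*, Progr. Math. 89 (1991),
  Prop. 2 and §1. [EdixhovenManin1991]
* J. E. Cremona, *Algorithms for modular elliptic curves*, 2nd ed., CUP 1997, §2.8 (p. 26).
  [CremonaAlgorithms1997]
* D. F. Lawden, *Elliptic Functions and Applications*, Springer 1989, §§6.15–6.16. [Lawden1989]
* J. H. Silverman, *The Arithmetic of Elliptic Curves*, GTM 106, Thm. VI.4.1(b), Cor. III.4.11.
  [SilvermanAEC2009]
-/

noncomputable section

open scoped ComplexConjugate

universe u

namespace Literature.NumberTheory.EllipticCurves.ModularForms.ModularParametrizationData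

open Complex CongruenceSubgroup _root_.PeriodPair

variable {W : WeierstrassCurve ℚ} {N : ℕ} [NeZero N] (D : ModularParametrizationData W N)

/-- `Ω(W) > 0` for an elliptic `W/ℚ` (the real period of `W ⊗ ℝ`; private helper).
[folklore] -/
private theorem realPeriodRat_pos_aux [W.IsElliptic] : 0 < W.realPeriodRat := by
  haveI : (W.baseChange ℝ).IsElliptic := by
    rw [WeierstrassCurve.baseChange]; infer_instance
  exact (W.baseChange ℝ).realPeriod_pos'

/-! ### §1. `re Λ_E = ℤ · Ω(W)/2` exactly: the generator is attained -/

/-- **The half Néron period is the real part of a period**: `Ω(W)/2 = re z` for some `z ∈ Λ_E`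
(so `re Λ_E = ℤ · Ω(W)/2` exactly, with `exists_re_eq_int_mul_realPeriodRat_div_two`). If `Δ > 0`
the lattice is rectangular, `Ω(W) = 2Ω₀` and `z = Ω₀`; if `Δ < 0` it is rhombic — `iΩ₀'/2 + Ω₀/2 ∈ Λ`
by `IsReal.discr_pos_of_halfPeriodI_add_notMem` (Lawden §6.16) — and `Ω(W) = Ω₀`, `z = iΩ₀'/2 + Ω₀/2`
(Cremona 1997 §2.8, p. 26: "`Ω(f)` is twice the least real part of a period").
[cite: CremonaAlgorithms1997, §2.8 (p. 26)] [cite: Lawden1989, §6.16] -/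
theorem exists_mem_lattice_re_eq_realPeriodRat_div_two [W.IsElliptic] :
    ∃ z ∈ D.L.lattice, z.re = W.realPeriodRat / 2 := by
  haveI : (W.baseChange ℝ).IsElliptic := by
    rw [WeierstrassCurve.baseChange]; infer_instance
  have hR : D.L.IsReal := D.isReal_neronLattice
  rw [D.realPeriodRat_eq_numRealComponents_mul]
  by_cases hΔ : 0 < (W.baseChange ℝ).Δ
  · refine ⟨(D.L.minRealPeriod : ℂ), hR.minRealPeriod_mem_lattice, ?_⟩
    rw [(W.baseChange ℝ).numRealComponents_of_Δ_pos hΔ, Complex.ofReal_re]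
    push_cast
    ring
  · have hΔ0 : (W.baseChange ℝ).Δ ≠ 0 := (W.baseChange ℝ).isUnit_Δ.ne_zero
    have hdisc : D.L.g₂.re ^ 3 - 27 * D.L.g₃.re ^ 2 ≠ 0 := by
      rw [D.discr_neronLattice]; exact hΔ0
    have hmem : I * (((D.L.mulLeft I I_ne_zero).minRealPeriod / 2 : ℝ) : ℂ) +
        ((D.L.minRealPeriod / 2 : ℝ) : ℂ) ∈ D.L.lattice := by
      by_contra hnot
      exact hΔ (by
        rw [← D.discr_neronLattice]
        exact hR.discr_pos_of_halfPeriodI_add_notMem hdisc hnot)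
    refine ⟨_, hmem, ?_⟩
    rw [(W.baseChange ℝ).numRealComponents_of_Δ_nonpos (not_lt.mp hΔ)]
    simp only [Complex.add_re, Complex.mul_re, Complex.I_re, Complex.I_im, Complex.ofReal_re,
      Complex.ofReal_im, zero_mul, one_mul, mul_zero, sub_zero, zero_add, Nat.cast_one]

/-! ### §3. The optimal curve: `Ω(W₀) = |c₀| · Ω⁺_f` exactly -/

/-- **The Néron period of a lattice-optimal datum against the period of the newform, EXACTLY.**
For a lattice-optimal datum `D₀` of an elliptic `W₀` (`Λ_{W₀} = c₀ Λ_f`, i.e. `hopt` together with the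
structure field `c₀Λ_f ⊆ Λ_{W₀}`): `Ω(W₀) = |c₀| · Ω⁺_f` — the factor `m ∣ 2` of
`exists_dvd_two_mul_realPeriodRat_eq_of_latticeEq` is `1`. Indeed `re Λ_{W₀} = c₀ · re Λ_f` with
`re Λ_{W₀} = ℤ · Ω(W₀)/2` (§1) and `re Λ_f = ℤ · Ω⁺_f/2` (definition of `plusPeriod`): writing
`Ω(W₀) = c₀ j Ω⁺_f` and `c₀ Ω⁺_f = k Ω(W₀)` with `j, k ∈ ℤ` gives `jk = 1`, `|k| = 1`.
(Edixhoven 1991 §1: `φ^*ω = c · 2πi f dτ`; Cremona §2.8.) [cite: EdixhovenManin1991, §1]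
[cite: CremonaAlgorithms1997, §2.8 (p. 26)] -/
theorem realPeriodRat_eq_abs_mul_plusPeriod_of_latticeEq [W.IsElliptic]
    (hopt : ∀ z ∈ D.L.lattice, ∃ w ∈ periodLattice D.f, z = D.c * w) :
    W.realPeriodRat = |(D.c : ℝ)| * plusPeriod D.f := by
  have hplus : 0 < plusPeriod D.f :=
    IsNewform0.plusPeriod_pos_holds D.isNewformOf.1 D.isNewformOf.coeffField_eq_bot
  have hre : realPeriods D.f = AddSubgroup.zmultiples (plusPeriod D.f / 2) :=
    realPeriods_eq_zmultiples_of_plusPeriod_pos D.f hplus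
  have hΩ : 0 < W.realPeriodRat := realPeriodRat_pos_aux (W := W)
  -- (i) `Ω(W)/2 = c j Ω⁺/2`
  obtain ⟨z, hz, hzre⟩ := D.exists_mem_lattice_re_eq_realPeriodRat_div_two
  obtain ⟨w, hw, hzw⟩ := hopt z hz
  have hwre : w.re ∈ realPeriods D.f := by
    rw [realPeriods, AddSubgroup.mem_map]
    exact ⟨w, hw, rfl⟩
  rw [hre, AddSubgroup.mem_zmultiples_iff] at hwre
  obtain ⟨j, hj⟩ := hwre
  have h1 : W.realPeriodRat = ((D.c : ℝ) * j) * plusPeriod D.f := by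
    have h := congrArg Complex.re hzw
    rw [hzre, Complex.mul_re, Complex.intCast_re, Complex.intCast_im, zero_mul, sub_zero, ← hj,
      zsmul_eq_mul] at h
    linarith
  -- (ii) `c Ω⁺/2 = k Ω(W)/2`
  have hmem : plusPeriod D.f / 2 ∈ realPeriods D.f := by
    rw [hre]; exact AddSubgroup.mem_zmultiples _
  rw [realPeriods, AddSubgroup.mem_map] at hmem
  obtain ⟨w', hw', hw're⟩ := hmem
  have hw're' : w'.re = plusPeriod D.f / 2 := by simpa using hw're
  obtain ⟨k, hk⟩ := D.exists_re_eq_int_mul_realPeriodRat_div_two (D.smul_periodLattice_le w' hw')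
  rw [Complex.mul_re, Complex.intCast_re, Complex.intCast_im, zero_mul, sub_zero, hw're'] at hk
  have h2 : (D.c : ℝ) * plusPeriod D.f = k * W.realPeriodRat := by linarith
  -- (iii) `j k = 1`, so `|k| = 1` and `Ω(W) = |c| Ω⁺`
  have hjk : ((j * k : ℤ) : ℝ) * W.realPeriodRat = 1 * W.realPeriodRat := by
    push_cast
    calc (j : ℝ) * k * W.realPeriodRat = j * ((D.c : ℝ) * plusPeriod D.f) := by rw [h2]; ring
      _ = W.realPeriodRat := by rw [h1]; ring
      _ = 1 * W.realPeriodRat := (one_mul _).symm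
  have hjkZ : k * j = 1 := by
    have h := mul_right_cancel₀ hΩ.ne' hjk
    rw [mul_comm]
    exact_mod_cast h
  have hk1 : |(k : ℝ)| = 1 := by
    rcases Int.eq_one_or_neg_one_of_mul_eq_one hjkZ with rfl | rfl <;> simp
  have habs : |(D.c : ℝ)| * plusPeriod D.f = |(k : ℝ)| * W.realPeriodRat := by
    have h := congrArg abs h2
    rwa [abs_mul, abs_mul, abs_of_pos hplus, abs_of_pos hΩ] at h
  rw [habs, hk1, one_mul]

end Literature.NumberTheory.EllipticCurves.ModularForms.ModularParametrizationData

namespace Literature.NumberTheory.EllipticCurves.SkinnerUrban2014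

open _root_.WeierstrassCurve

/-! ### §2. The lattice step with full Néron periods (no component factors) -/

section Lattice

open scoped MatrixGroups ModularForm
open Complex CongruenceSubgroup Literature.NumberTheory.EllipticCurves.ModularForms _root_.PeriodPair

variable {W W' : WeierstrassCurve ℚ} [W.IsElliptic] [W'.IsElliptic] {N N' : ℕ} [NeZero N]
  [NeZero N']

/-- For an integer `z` not divisible by the prime `p`, `‖z‖_p = 1` (private helper). [folklore] -/
private theorem padicNorm_intCast_eq_one_of_not_dvd' {p : ℕ} [Fact p.Prime] {z : ℤ}
    (h : ¬ (p : ℤ) ∣ z) : ‖(z : ℚ_[p])‖ = 1 :=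
  le_antisymm (Padic.norm_int_le_one z)
    (not_lt.mp fun hlt ↦ h (Padic.norm_intCast_lt_one_iff.mp hlt))

/-- **The Néron periods of two globally minimal models under a `ℚ`-isogeny, without component
factors.** Let `ψ : W → W'` be an isogeny over `ℚ` of degree `d` between GLOBALLY MINIMAL elliptic
curves with modular parametrisation data `D, D'` (used only for their Néron-type period pairs
`Λ = Λ_W`, `Λ' = Λ_{W'}`). Then there are integers `q, a, b` with `q ∣ d`, `a · b = d` and
`q · Ω(W) = a · Ω(W')` for the FULL Néron periods `Ω = ∫_{E(ℝ)}|ω|` (components included). As in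
`exists_int_mul_minRealPeriod_eq_of_isogeny`: `ψ` is `z ↦ qz` with `qΛ ⊆ Λ'`, `[Λ' : qΛ] = d`
(`exists_rat_mulLeft_lattice_le_of_isogeny`), `q, d/q ∈ ℤ` by Néron integrality
(`integral_neronScaling_of_isGloballyMinimal_holds`), but now read on REAL PARTS: `re Λ = ℤ · Ω(W)/2`,
`re Λ' = ℤ · Ω(W')/2` exactly (§1), so `q · Ω(W)/2 = a · Ω(W')/2` and `(d/q) · Ω(W')/2 = b · Ω(W)/2`
with `ab = d`. (Greenberg–Vatsal 2000 §3 Remark 3.4, bookkeeping; Silverman *AEC* VI.4.1(b).)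
[cite: GreenbergVatsal2000, §3, Remark 3.4] [cite: SilvermanAEC2009, Thm. VI.4.1(b)] -/
theorem exists_int_mul_realPeriodRat_eq_of_isogeny [W.IsGloballyMinimal] [W'.IsGloballyMinimal]
    (D : ModularParametrizationData W N) (D' : ModularParametrizationData W' N')
    (ψ : Isogeny W W') :
    ∃ q a b : ℤ, q ≠ 0 ∧ q ∣ (ψ.degree : ℤ) ∧ a * b = ψ.degree ∧
      (q : ℝ) * W.realPeriodRat = a * W'.realPeriodRat := by
  obtain ⟨r, hr0, hle, hidx⟩ :=
    exists_rat_mulLeft_lattice_le_of_isogeny W W' D.isNeronLattice D'.isNeronLattice ψ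
  set d : ℕ := ψ.degree with hd
  have hr0' : (r : ℚ) ≠ 0 := by
    rintro rfl
    exact hr0 (by push_cast; rfl)
  -- `rΛ ⊆ Λ'`
  have hmem : ∀ z ∈ D.L.lattice, ((r : ℚ) : ℂ) * z ∈ D'.L.lattice := fun z hz ↦
    hle (mul_mem_mulLeft_lattice.mpr hz)
  -- `r ∈ ℤ`
  obtain ⟨q, hq⟩ := integral_neronScaling_of_isGloballyMinimal_holds W W' D.L D'.L D.isNeronLattice
    D'.isNeronLattice r hmem
  -- `dΛ' ⊆ rΛ`, i.e. `(d/r)Λ' ⊆ Λ`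
  have hdmem : ∀ z ∈ D'.L.lattice, ((d / r : ℚ) : ℂ) * z ∈ D.L.lattice := by
    intro z hz
    have h1 : d • z ∈ (D.L.mulLeft (r : ℂ) hr0).lattice := by
      have h2 := AddSubgroup.nsmul_relIndex_mem (D.L.mulLeft (r : ℂ) hr0).lattice.toAddSubgroup
        (K := D'.L.lattice.toAddSubgroup) (g := z) hz
      rw [hidx] at h2
      exact h2
    rw [mem_mulLeft_lattice, nsmul_eq_mul] at h1
    have e : ((d / r : ℚ) : ℂ) * z = ((r : ℚ) : ℂ)⁻¹ * ((d : ℂ) * z) := by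
      push_cast
      ring
    rw [e]
    exact h1
  obtain ⟨q', hq'⟩ := integral_neronScaling_of_isGloballyMinimal_holds W' W D'.L D.L
    D'.isNeronLattice D.isNeronLattice (d / r) hdmem
  have hqq' : q * q' = d := by
    have h : (q : ℚ) * q' = d := by
      rw [hq, hq']
      field_simp
    exact_mod_cast h
  -- the half periods as real parts of lattice points
  obtain ⟨z, hz, hzre⟩ := D.exists_mem_lattice_re_eq_realPeriodRat_div_two
  obtain ⟨z', hz', hz're⟩ := D'.exists_mem_lattice_re_eq_realPeriodRat_div_two
  obtain ⟨a, ha⟩ := D'.exists_re_eq_int_mul_realPeriodRat_div_two (hmem z hz)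
  obtain ⟨b, hb⟩ := D.exists_re_eq_int_mul_realPeriodRat_div_two (hdmem z' hz')
  have hre1 : (((r : ℚ) : ℂ) * z).re = ((r : ℚ) : ℝ) * (W.realPeriodRat / 2) := by
    rw [show ((r : ℚ) : ℂ) = (((r : ℚ) : ℝ) : ℂ) by norm_cast, Complex.re_ofReal_mul, hzre]
  have hre2 : (((d / r : ℚ) : ℂ) * z').re = ((d / r : ℚ) : ℝ) * (W'.realPeriodRat / 2) := by
    rw [show ((d / r : ℚ) : ℂ) = (((d / r : ℚ) : ℝ) : ℂ) by norm_cast, Complex.re_ofReal_mul, hz're]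
  rw [hre1] at ha
  rw [hre2] at hb
  have hpos : 0 < W.realPeriodRat := by
    haveI : (W.baseChange ℝ).IsElliptic := by
      rw [WeierstrassCurve.baseChange]; infer_instance
    exact (W.baseChange ℝ).realPeriod_pos'
  have hpos' : 0 < W'.realPeriodRat := by
    haveI : (W'.baseChange ℝ).IsElliptic := by
      rw [WeierstrassCurve.baseChange]; infer_instance
    exact (W'.baseChange ℝ).realPeriod_pos'
  have hab : a * b = d := by
    -- multiply the two relations: `r (Ω/2) · (d/r) (Ω'/2) = a b (Ω'/2) (Ω/2)`
    have h1 : (((r : ℚ) : ℝ) * (W.realPeriodRat / 2)) * (((d / r : ℚ) : ℝ) * (W'.realPeriodRat / 2)) =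
        (a * b : ℝ) * ((W.realPeriodRat / 2) * (W'.realPeriodRat / 2)) := by
      rw [ha, hb]; ring
    have hrR : ((r : ℚ) : ℝ) ≠ 0 := by exact_mod_cast hr0'
    have h2 : (((r : ℚ) : ℝ) * (W.realPeriodRat / 2)) * (((d / r : ℚ) : ℝ) * (W'.realPeriodRat / 2)) =
        (d : ℝ) * ((W.realPeriodRat / 2) * (W'.realPeriodRat / 2)) := by
      push_cast
      field_simp
    have h3 : ((a * b : ℤ) : ℝ) = d := by
      have h := h1.symm.trans h2
      have hne : (W.realPeriodRat / 2) * (W'.realPeriodRat / 2) ≠ 0 := by positivity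
      exact_mod_cast mul_right_cancel₀ hne h
    exact_mod_cast h3
  refine ⟨q, a, b, ?_, ⟨q', hqq'.symm⟩, hab, ?_⟩
  · rintro rfl
    exact hr0' (by rw [← hq]; simp)
  · have hqr : (q : ℝ) = ((r : ℚ) : ℝ) := by exact_mod_cast hq
    rw [hqr]
    linarith

/-! ### §4. Assembly at EVERY prime: `Ω(W) = u · Ω⁺_f` with `‖u‖_p = 1` -/

/-- **Greenberg–Vatsal 2000, §3, Remark 3.4 / Skinner–Urban 2014, §3.6.7, at EVERY prime `p`
(including `p = 2`), PROVED modulo the Manin constant of the optimal curve.** Let `W/ℚ` be a globally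
minimal elliptic curve, `p` ANY prime with `E[p]` irreducible, `f ∈ S₂(Γ₀(N))` the newform of `W`,
and assume (`hc`) that the Manin constant `c₀` of the lattice-optimal datum at level `N` (on a
globally minimal model `W₀` of the strong Weil curve, `Λ_{W₀} = c₀Λ_f`) is prime to `p`. Then
`Ω(W) = u · Ω⁺_f` with `u ∈ ℚ`, `‖u‖_p = 1`, explicitly `u = a |c₀| / q` where `q ∣ d`, `ab = d` for an
isogeny `ψ : W → W₀` of degree `d` prime to `p` (`exists_isogeny_not_dvd_degree_of_irreducible`;
`exists_int_mul_realPeriodRat_eq_of_isogeny`; `realPeriodRat_eq_abs_mul_plusPeriod_of_latticeEq`).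
Compared with `exists_unit_mul_plusPeriod_of_irreducible` (odd `p`) the factors `n, n₀, m ∣ 2` are
gone, so `p = 2` is allowed. [cite: GreenbergVatsal2000, §3, Remark 3.4]
[cite: SkinnerUrban2014, §3.6.7 (p. 45)] [cite: EdixhovenManin1991, Prop. 2 and §1] -/
theorem exists_unit_mul_plusPeriod_of_irreducible_anyPrime (W : WeierstrassCurve ℚ) [W.IsElliptic]
    [W.IsGloballyMinimal] (p : ℕ) [Fact p.Prime]
    (hirr : W.HasIrreducibleModPGaloisRep p) (f : CuspForm (Gamma0 N) 2) (hf : IsNewformOf W f)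
    (hc : ∀ (W₀ : WeierstrassCurve ℚ) [W₀.IsElliptic] [W₀.IsGloballyMinimal]
      (D₀ : ModularParametrizationData W₀ N), D₀.f = f →
      (∀ z ∈ D₀.L.lattice, ∃ w ∈ periodLattice D₀.f, z = D₀.c * w) → ¬ (p : ℤ) ∣ D₀.maninConstant) :
    ∃ u : ℚ, ‖(u : ℚ_[p])‖ = 1 ∧ W.realPeriodRat = u * plusPeriod f := by
  have hpP : p.Prime := Fact.out
  -- a datum of `W` at level `N`, with newform `f`
  obtain ⟨D⟩ := Literature.NumberTheory.Automorphic.nonempty_modularParametrizationData_of_isNewformOf hf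
  have hDf : D.f = f := D.isNewformOf.unique hf
  subst hDf
  -- the optimal datum on a globally minimal model of the strong Weil curve
  obtain ⟨W₀, hW₀, hW₀', D₀, hf₀, hiso, hopt, -⟩ :=
    D.exists_optimalDatum_of_edixhoven
      (fun hf' hL' q hq hq' ↦ edixhoven_int_of_neronLattice_eq_smul_periodLattice_holds hf' hL' q hq hq')
  have hc₀ : ¬ (p : ℤ) ∣ D₀.c := hc W₀ D₀ hf₀ hopt
  -- an isogeny `W → W₀` of degree prime to `p`
  obtain ⟨ψ, hψ⟩ := exists_isogeny_not_dvd_degree_of_irreducible (W := W) (W' := W₀)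
    (Nat.cast_ne_zero.mpr hpP.ne_zero) hirr hiso
  -- the lattice step (full periods) and the optimal-curve step (exact)
  obtain ⟨q, a, b, hq0, hqd, hab, hqa⟩ := exists_int_mul_realPeriodRat_eq_of_isogeny D D₀ ψ
  have hm := D₀.realPeriodRat_eq_abs_mul_plusPeriod_of_latticeEq hopt
  rw [hf₀] at hm
  have hq0' : (q : ℝ) ≠ 0 := by exact_mod_cast hq0
  -- not divisible by `p`
  have hpa : ¬ (p : ℤ) ∣ a := fun h ↦ hψ (Int.natCast_dvd_natCast.mp (hab ▸ h.mul_right b))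
  have hpq : ¬ (p : ℤ) ∣ q := fun h ↦ hψ (Int.natCast_dvd_natCast.mp (h.trans hqd))
  have hpc : ¬ (p : ℤ) ∣ |D₀.c| := fun h ↦ hc₀ ((dvd_abs _ _).mp h)
  refine ⟨((a : ℚ) * (|D₀.c| : ℤ)) / (q : ℚ), ?_, ?_⟩
  · have e : ((((a : ℚ) * (|D₀.c| : ℤ)) / (q : ℚ) : ℚ) : ℚ_[p]) =
        ((a : ℚ_[p]) * ((|D₀.c| : ℤ) : ℚ_[p])) / (q : ℚ_[p]) := by
      simp only [Rat.cast_div, Rat.cast_mul, Rat.cast_intCast]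
    rw [e, norm_div, norm_mul, padicNorm_intCast_eq_one_of_not_dvd' hpa,
      padicNorm_intCast_eq_one_of_not_dvd' hpc, padicNorm_intCast_eq_one_of_not_dvd' hpq]
    norm_num
  · -- `Ω(W) = (a/q) Ω(W₀) = a |c₀| Ω⁺_f / q`
    rw [← Int.cast_abs] at hm
    have h1 : W.realPeriodRat * (q : ℝ) = ((a : ℝ) * ((|D₀.c| : ℤ) : ℝ)) * plusPeriod D.f := by
      calc W.realPeriodRat * (q : ℝ) = (q : ℝ) * W.realPeriodRat := mul_comm _ _
        _ = a * W₀.realPeriodRat := hqa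
        _ = ((a : ℝ) * ((|D₀.c| : ℤ) : ℝ)) * plusPeriod D.f := by rw [hm]; ring
    have hcast : ((((a : ℚ) * (|D₀.c| : ℤ)) / (q : ℚ) : ℚ) : ℝ) =
        ((a : ℝ) * ((|D₀.c| : ℤ) : ℝ)) / (q : ℝ) := by
      simp only [Rat.cast_div, Rat.cast_mul, Rat.cast_intCast]
    rw [hcast, div_mul_eq_mul_div, eq_div_iff hq0']
    exact h1

end Lattice

/-! ### §5. The `p = 2` named consequences, from the Manin constant at `2` (Abbes–Ullmo 1996 Thm. A for
`2 ∤ N`; Česnavičius 2018 Thm. 1.2 for `2 ∥ N`) -/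

section NamedFacts

open scoped MatrixGroups ModularForm
open CongruenceSubgroup Literature.NumberTheory.EllipticCurves.ModularForms

/-- **The period unit at ANY prime `p ∤ N` (including `p = 2`) with `E[p]` irreducible, from
Abbes–Ullmo 1996, Thm. A** (the Manin constant of the optimal curve is prime to every `p ∤ N`; tree
named fact `abbesUllmo_not_dvd_maninConstant_of_not_dvd_level`, NOT discharged here): for a globally
minimal elliptic `W/ℚ` with newform `f ∈ S₂(Γ₀(N))`, `Ω(W) = u · Ω⁺_f`, `u ∈ ℚ`, `‖u‖_p = 1`. The
odd-`p` version is `exists_unit_mul_plusPeriod_of_irreducible_of_abbesUllmo`.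
[cite: AbbesUllmo1996, Thm. A] [cite: GreenbergVatsal2000, §3, Remark 3.4] -/
theorem exists_unit_mul_plusPeriod_of_irreducible_of_abbesUllmo_anyPrime
    (hAU : abbesUllmo_not_dvd_maninConstant_of_not_dvd_level) (W : WeierstrassCurve ℚ)
    [W.IsElliptic] [W.IsGloballyMinimal] (p : ℕ) [Fact p.Prime]
    (hirr : W.HasIrreducibleModPGaloisRep p) {N : ℕ} [NeZero N] (f : CuspForm (Gamma0 N) 2)
    (hf : IsNewformOf W f) (hpN : ¬ p ∣ N) :
    ∃ u : ℚ, ‖(u : ℚ_[p])‖ = 1 ∧ W.realPeriodRat = u * plusPeriod f :=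
  exists_unit_mul_plusPeriod_of_irreducible_anyPrime W p hirr f hf
    fun W₀ _ _ D₀ _ hopt ↦ hAU W₀ D₀ hopt p Fact.out hpN

/-- **The period unit at `p = 2` for GOOD reduction at `2` (`2 ∤ N_W`) and `E[2]` irreducible, from
Abbes–Ullmo 1996, Thm. A** — the `p = 2` companion of the Literature fact
`realPeriodRat_eq_unit_mul_plusPeriod` (`p ≥ 5`) / `…_three`: for a globally minimal elliptic `W/ℚ`
with good reduction at `2`, `ρ̄_{E,2}` irreducible (`E(ℚ)[2] = 0`), and its newform `f` (any level):
`Ω(W) = u · Ω⁺_f`, `u ∈ ℚ`, `‖u‖₂ = 1`. (Greenberg–Vatsal 2000 §3 Remark 3.4 has no parity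
restriction; at a good `p` the level is prime to `p`, `not_dvd_level_of_hasGoodReductionAtPrime`.)
[cite: GreenbergVatsal2000, §3, Remark 3.4] [cite: AbbesUllmo1996, Thm. A] -/
theorem realPeriodRat_eq_unit_mul_plusPeriod_two_of_abbesUllmo
    (hAU : abbesUllmo_not_dvd_maninConstant_of_not_dvd_level) (W : WeierstrassCurve ℚ)
    [W.IsElliptic] [W.IsGloballyMinimal] (hgood : W.HasGoodReductionAtPrime 2)
    (hirr : W.HasIrreducibleModPGaloisRep 2) {N : ℕ} [NeZero N] (f : CuspForm (Gamma0 N) 2)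
    (hf : IsNewformOf W f) :
    ∃ u : ℚ, ‖(u : ℚ_[2])‖ = 1 ∧ W.realPeriodRat = u * plusPeriod f :=
  exists_unit_mul_plusPeriod_of_irreducible_of_abbesUllmo_anyPrime hAU W 2 hirr f hf
    (not_dvd_level_of_hasGoodReductionAtPrime hgood hf)

/-- **The period unit at `p = 2` for MULTIPLICATIVE reduction at `2` (`2 ∥ N_W`) and `E[2]`
irreducible, from Česnavičius 2018, Thm. 1.2** (the Manin constant of the optimal curve is odd when
`2 ∥ N`; tree named fact `cesnavicius_not_two_dvd_maninConstant_of_two_dvd_level`, NOT discharged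
here; "existing techniques suffice if `p` is odd, so the key new case is `p = 2`"): for a globally
minimal elliptic `W/ℚ` with multiplicative reduction at `2`, `ρ̄_{E,2}` irreducible and newform `f`:
`Ω(W) = u · Ω⁺_f`, `‖u‖₂ = 1`. The level satisfies `2 ∣ N` (bad reduction: Mathlib's
`HasMultiplicativeReduction.not_hasGoodReduction`, `dvd_conductorNorm_iff_not_hasGoodReductionAtPrime`,
Atkin–Lehner `dvd_level_iff_dvd_conductorNorm`) and `4 ∤ N`
(`not_sq_dvd_level_of_hasMultiplicativeReductionAtPrime`).
[cite: Cesnavicius2018, Thm. 1.2] [cite: GreenbergVatsal2000, §3, Remark 3.4] -/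
theorem realPeriodRat_eq_unit_mul_plusPeriod_two_of_cesnavicius
    (hC : cesnavicius_not_two_dvd_maninConstant_of_two_dvd_level) (W : WeierstrassCurve ℚ)
    [W.IsElliptic] [W.IsGloballyMinimal] (hmult : W.HasMultiplicativeReductionAtPrime 2)
    (hirr : W.HasIrreducibleModPGaloisRep 2) {N : ℕ} [NeZero N] (f : CuspForm (Gamma0 N) 2)
    (hf : IsNewformOf W f) :
    ∃ u : ℚ, ‖(u : ℚ_[2])‖ = 1 ∧ W.realPeriodRat = u * plusPeriod f := by
  have hngood : ¬ W.HasGoodReductionAtPrime 2 :=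
    WeierstrassCurve.HasMultiplicativeReduction.not_hasGoodReduction (R := ℤ_[2]) hmult
  have h2N : 2 ∣ N :=
    (hf.dvd_level_iff_dvd_conductorNorm Fact.out).mpr
      ((W.dvd_conductorNorm_iff_not_hasGoodReductionAtPrime 2).mpr hngood)
  have h4N : ¬ 2 ^ 2 ∣ N := not_sq_dvd_level_of_hasMultiplicativeReductionAtPrime hmult hf
  exact exists_unit_mul_plusPeriod_of_irreducible_anyPrime W 2 hirr f hf
    fun W₀ _ _ D₀ _ hopt ↦ hC W₀ D₀ hopt h2N h4N

/-- **The period unit at `p = 2` on the whole semistable-at-`2` locus** (`4 ∤ N_W`: good or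
multiplicative reduction at `2`) with `E[2]` irreducible, from the two Manin-constant facts
(Abbes–Ullmo Thm. A; Česnavičius Thm. 1.2). This is "A-PER2" of the residual cell `b2b-bsdres`
(class O1 = X5 at `p = 2`; o1 lead PLAN v2.2 C24): on sub-class O1-A the period slack `m` of the
END-STATE is `0`. [cite: GreenbergVatsal2000, §3, Remark 3.4] [cite: Cesnavicius2018, Thm. 1.2]
[cite: AbbesUllmo1996, Thm. A] -/
theorem exists_unit_mul_plusPeriod_two_of_not_additive
    (hAU : abbesUllmo_not_dvd_maninConstant_of_not_dvd_level)
    (hC : cesnavicius_not_two_dvd_maninConstant_of_two_dvd_level) (W : WeierstrassCurve ℚ)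
    [W.IsElliptic] [W.IsGloballyMinimal]
    (hred : W.HasGoodReductionAtPrime 2 ∨ W.HasMultiplicativeReductionAtPrime 2)
    (hirr : W.HasIrreducibleModPGaloisRep 2) {N : ℕ} [NeZero N] (f : CuspForm (Gamma0 N) 2)
    (hf : IsNewformOf W f) :
    ∃ u : ℚ, ‖(u : ℚ_[2])‖ = 1 ∧ W.realPeriodRat = u * plusPeriod f := by
  rcases hred with hgood | hmult
  · exact realPeriodRat_eq_unit_mul_plusPeriod_two_of_abbesUllmo hAU W hgood hirr f hf
  · exact realPeriodRat_eq_unit_mul_plusPeriod_two_of_cesnavicius hC W hmult hirr f hf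

/-- **The inline period-unit binder at `2`**: under the hypotheses of
`exists_unit_mul_plusPeriod_two_of_not_additive`, every `ϖ ∈ ℚ` with `ϖ · Ω(W) = Ω⁺_f` has
`ord₂ ϖ = 0` (`ϖ = u⁻¹`; `Rank1Residual.padicValRat_periodRatio_eq_zero_of_eq_unit_mul`). This is the
`m = 0` input of the cell's `X5/TwoAdicTargetsEndState.lean` (`hper` / `hϖ`).
[cite: GreenbergVatsal2000, §3, Remark 3.4] [cite: Cesnavicius2018, Thm. 1.2] -/
theorem padicValRat_two_periodRatio_eq_zero
    (hAU : abbesUllmo_not_dvd_maninConstant_of_not_dvd_level)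
    (hC : cesnavicius_not_two_dvd_maninConstant_of_two_dvd_level) (W : WeierstrassCurve ℚ)
    [W.IsElliptic] [W.IsGloballyMinimal]
    (hred : W.HasGoodReductionAtPrime 2 ∨ W.HasMultiplicativeReductionAtPrime 2)
    (hirr : W.HasIrreducibleModPGaloisRep 2) {N : ℕ} [NeZero N] (f : CuspForm (Gamma0 N) 2)
    (hf : IsNewformOf W f) (ϖ : ℚ) (hϖ : (ϖ : ℝ) * W.realPeriodRat = plusPeriod f) :
    padicValRat 2 ϖ = 0 := by
  obtain ⟨u, hu, hΩ⟩ := exists_unit_mul_plusPeriod_two_of_not_additive hAU hC W hred hirr f hf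
  exact Rank1Residual.padicValRat_periodRatio_eq_zero_of_eq_unit_mul W 2 f hu hΩ ϖ hϖ

/-- **The named fact `realPeriodRat_eq_unit_mul_plusPeriod_two` of `ModularCurvePeriodRatio.lean`
(good reduction at `2`, `E[2]` irreducible: `Ω(W) = u · Ω⁺_f`, `‖u‖₂ = 1`) BY NAME, from Abbes–Ullmo
1996, Thm. A alone** — the `p = 2` companion of `realPeriodRat_eq_unit_mul_plusPeriod_of_abbesUllmo` /
`realPeriodRat_eq_unit_mul_plusPeriod_three_of_abbesUllmo` (`PAdicUnitPeriodRatioProofs.lean`). The body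
of that fact is, token for token, the conclusion of `realPeriodRat_eq_unit_mul_plusPeriod_two_of_abbesUllmo`
above, so over the tree the fact is a COROLLARY of the single lattice-form Manin-constant fact
`abbesUllmo_not_dvd_maninConstant_of_not_dvd_level` (`2 ∤ c₀` for `2 ∤ N`), Edixhoven's
`Λ(ω_{E₀}) = c₀Λ_f` (`Ω(E₀) = |c₀|·Ω⁺_f`, §3) and Greenberg–Vatsal's Remark 3.4 at `p = 2` (odd isogeny
degree to the optimal curve, §§2, 4) being PROVED here. Consumers that display the fact as a hypothesis
(e.g. the `p = 2` theta-partner / unit-zone doors of `BirchSwinnertonDyer`) may feed it from `hAU` by this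
name. [cite: AbbesUllmo1996, Thm. A] [cite: GreenbergVatsal2000, §3, Remark 3.4]
[cite: EdixhovenManin1991, Prop. 2 and §1] -/
theorem realPeriodRat_eq_unit_mul_plusPeriod_two_fact_of_abbesUllmo
    (hAU : abbesUllmo_not_dvd_maninConstant_of_not_dvd_level) :
    realPeriodRat_eq_unit_mul_plusPeriod_two := by
  intro W _ _ hgood hirr N _ f hf
  exact realPeriodRat_eq_unit_mul_plusPeriod_two_of_abbesUllmo hAU W hgood hirr f hf

/-- **The three good-reduction period-unit facts of `ModularCurvePeriodRatio.lean` are ONE print input**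
(Abbes–Ullmo 1996, Thm. A in lattice form, `abbesUllmo_not_dvd_maninConstant_of_not_dvd_level`):
`realPeriodRat_eq_unit_mul_plusPeriod` (good `p ≥ 5`), `…_three` (good `3`), `…_two` (good `2`), each with
`E[p]` irreducible — the `p`-adic analogue of `periodUnit_facts_of_mazur` (which cannot reach `p = 2`:
Mazur's `p² ∣ 4N` is void at `2`). [cite: AbbesUllmo1996, Thm. A] [cite: GreenbergVatsal2000, §3, Remark 3.4] -/
theorem periodUnit_good_facts_of_abbesUllmo
    (hAU : abbesUllmo_not_dvd_maninConstant_of_not_dvd_level) :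
    realPeriodRat_eq_unit_mul_plusPeriod ∧ realPeriodRat_eq_unit_mul_plusPeriod_three ∧
      realPeriodRat_eq_unit_mul_plusPeriod_two :=
  ⟨realPeriodRat_eq_unit_mul_plusPeriod_of_abbesUllmo hAU,
    realPeriodRat_eq_unit_mul_plusPeriod_three_of_abbesUllmo hAU,
    realPeriodRat_eq_unit_mul_plusPeriod_two_fact_of_abbesUllmo hAU⟩

end NamedFacts

end Literature.NumberTheory.EllipticCurves.SkinnerUrban2014

end
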